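import Summits.RiemannHypothesis.RiemannHypothesis.Theorems.UniversalFactorNarrowKernelNoGoEnergyUpperKernel
import Literature.NumberTheory.LFunctions.DirichletMVTSharp
import Literature.NumberTheory.LFunctions.AFEHarmonicSums
import Literature.Analysis.Fourier.GaussianMeanValue

/-!
# RiemannHypothesis / UniversalFactor — `NarrowKernelNoGo`, stub K1b (energy upper bound), part 5:
the filtered Dirichlet polynomial in mean square (blocks, freezing, Montgomery–Vaughan)

Route `RiemannHypothesis/UniversalFactor`, crux `NarrowKernelNoGo` (stmt-RiemannHypothesis-2576), line
`Sketch`, stub `stub_narrowEnergyUpper`. The main term of the filtered Hardy function is governed by the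
Dirichlet polynomial with slowly varying coefficients

  `D(t) = ∑_{n ≤ P} n^{-1/2} e^{-it log n} ĝ(½ log(t/2π) − log n)`,

`ĝ = G` the transform of the kernel profile (`‖G(ω)‖² ≤ G₀/(1+ω²)`, `‖G(ω) − G(ω')‖ ≤ G₁|ω − ω'|`).
This file proves the log-free bound `∫_T^{2T+1} ‖D‖² ≤ (690 G₀(1+3π) + 16 G₁²) T` (`P ≤ √T`):

* `UniversalFactor.narrowUpper_frozen_meanSquare` — coefficients frozen at `T'`: Montgomery–Vaughan
  (`DirichletMVT.meanSquare_shift_le`) and the log-free harmonic sum give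
  `∫_{T'}^{T'+U} ‖D_{T'}‖² ≤ (5U/2 + 20 + 65P) G₀ (1+3π)`;
* `UniversalFactor.narrowUpper_frozen_diff_le` — freezing costs `‖D(t) − D_{T'}(t)‖ ≤ √P G₁ (t−T')/T'`;
* `UniversalFactor.narrowUpper_block_le`, `UniversalFactor.narrowUpper_main_meanSquare` — blocks of
  length `U = (T+1)/⌈√(T+1)⌉` and the sum over blocks.

References: Titchmarsh, *The Theory of the Riemann Zeta-Function* (1986), §7.2–7.4; H. L. Montgomery,
R. C. Vaughan, *Hilbert's inequality*, J. London Math. Soc. (2) 8 (1974), 73–82.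
-/

noncomputable section

-- D-0017: `Summit.<S>.<S>.…` is the designed namespace of a single-problem summit.
set_option linter.dupNamespace false

namespace Summit.RiemannHypothesis.RiemannHypothesis.Theorems

open MeasureTheory Set Filter Complex intervalIntegral
open scoped Real Topology
open Literature.NumberTheory.LFunctions

/-! ## The frozen polynomial: Montgomery–Vaughan and the log-free sum -/

/-- `‖n^{-1/2}‖² = 1/n` for the real coefficient cast to `ℂ` (`n ≥ 1`). [folklore] -/
theorem UniversalFactor.narrowUpper_norm_coef_sq {n : ℕ} (hn : 1 ≤ n) :
    ‖((((n : ℝ) ^ (-(1 / 2 : ℝ))) : ℝ) : ℂ)‖ ^ 2 = (n : ℝ)⁻¹ := by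
  have hn0 : (0 : ℝ) < n := by exact_mod_cast hn
  rw [Complex.norm_real, Real.norm_eq_abs, abs_of_nonneg (Real.rpow_nonneg hn0.le _), ← Real.rpow_natCast,
    ← Real.rpow_mul hn0.le]
  norm_num
  rw [Real.rpow_neg_one]

/-- `‖n^{-1/2}‖ = n^{-1/2}` and `‖e^{-it log n}‖ = 1`: the norm of the `n`-th phase-coefficient. [folklore] -/
theorem UniversalFactor.narrowUpper_norm_coef_mul_cexp {n : ℕ} (hn : 1 ≤ n) (t : ℝ) :
    ‖((((n : ℝ) ^ (-(1 / 2 : ℝ))) : ℝ) : ℂ) * cexp (-(I * t * Real.log n))‖ = (n : ℝ) ^ (-(1 / 2 : ℝ)) := by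
  have hn0 : (0 : ℝ) < n := by exact_mod_cast hn
  rw [norm_mul, Literature.Analysis.Fourier.GaussianMeanValue.norm_cexp_neg_I_mul_mul, mul_one, Complex.norm_real, Real.norm_eq_abs,
    abs_of_nonneg (Real.rpow_nonneg hn0.le _)]

/-- **The frozen polynomial in mean square.** For coefficients `n^{-1/2} G(L' − log n)` with
`‖G(ω)‖² ≤ G₀/(1+ω²)`: `∫_{T'}^{T'+U} ‖∑_{n≤P} n^{-1/2} e^{-it log n} G(L' − log n)‖² dt ≤ (5U/2 + 20 + 65P) G₀ (1+3π)`
(Montgomery–Vaughan `∑ (5W + 20 + 65n)|a_n|²` and `∑ 1/(n(1+(L'−log n)²)) ≤ 1 + 3π`).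
[cite: MontgomeryVaughan1974, Thm. 1] -/
theorem UniversalFactor.narrowUpper_frozen_meanSquare {G : ℝ → ℂ} {G₀ : ℝ}
    (hG3 : ∀ ω : ℝ, ‖G ω‖ ^ 2 ≤ G₀ / (1 + ω ^ 2)) (hG₀ : 0 ≤ G₀) (P : ℕ) (L' T' : ℝ) {U : ℝ} (hU : 0 < U) :
    ∫ t in T'..(T' + U), ‖∑ n ∈ Finset.Icc 1 P, ((((n : ℝ) ^ (-(1 / 2 : ℝ))) : ℝ) : ℂ) *
        cexp (-(I * t * Real.log n)) * G (L' - Real.log n)‖ ^ 2 ≤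
      (5 * (U / 2) + 20 + 65 * P) * (G₀ * (1 + 3 * π)) := by
  set a : ℕ → ℂ := fun n => ((((n : ℝ) ^ (-(1 / 2 : ℝ))) : ℝ) : ℂ) * G (L' - Real.log n) with ha
  have heq : ∀ t : ℝ, ∑ n ∈ Finset.Icc 1 P, ((((n : ℝ) ^ (-(1 / 2 : ℝ))) : ℝ) : ℂ) *
      cexp (-(I * t * Real.log n)) * G (L' - Real.log n) = ∑ n ∈ Finset.Icc 1 P, a n * (n : ℂ) ^ (-((t : ℂ) * I)) := by
    intro t
    refine Finset.sum_congr rfl fun n hn => ?_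
    have hn0 : n ≠ 0 := by have := (Finset.mem_Icc.1 hn).1; omega
    rw [natCast_cpow_neg_mul_I hn0 t, show -(I * (t : ℂ) * (Real.log n : ℂ)) = ((-(t * Real.log n) : ℝ) : ℂ) * I by
      push_cast; ring]
    simp only [ha]; ring
  have hcongr : ∫ t in T'..(T' + U), ‖∑ n ∈ Finset.Icc 1 P, ((((n : ℝ) ^ (-(1 / 2 : ℝ))) : ℝ) : ℂ) *
      cexp (-(I * t * Real.log n)) * G (L' - Real.log n)‖ ^ 2 =
      ∫ t in T'..(T' + U), ‖∑ n ∈ Finset.Icc 1 P, a n * (n : ℂ) ^ (-((t : ℂ) * I))‖ ^ 2 :=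
    intervalIntegral.integral_congr fun t _ => by simp only [heq t]
  rw [hcongr]
  have hMVT := DirichletMVT.meanSquare_shift_le a P (W := U / 2) (by positivity) (T' + U / 2)
  rw [show T' + U / 2 - U / 2 = T' by ring, show T' + U / 2 + U / 2 = T' + U by ring] at hMVT
  refine hMVT.trans ?_
  have han : ∀ n ∈ Finset.Icc 1 P, ‖a n‖ ^ 2 ≤ G₀ * (1 / ((n : ℝ) * (1 + (L' - Real.log n) ^ 2))) := by
    intro n hn
    have hn1 : 1 ≤ n := (Finset.mem_Icc.1 hn).1
    have hn0 : (0 : ℝ) < n := by exact_mod_cast hn1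
    simp only [ha]
    rw [norm_mul, mul_pow, UniversalFactor.narrowUpper_norm_coef_sq hn1]
    calc (n : ℝ)⁻¹ * ‖G (L' - Real.log n)‖ ^ 2 ≤ (n : ℝ)⁻¹ * (G₀ / (1 + (L' - Real.log n) ^ 2)) := by
          gcongr; exact hG3 _
      _ = G₀ * (1 / ((n : ℝ) * (1 + (L' - Real.log n) ^ 2))) := by field_simp
  calc ∑ n ∈ Finset.Icc 1 P, (5 * (U / 2) + 20 + 65 * n) * ‖a n‖ ^ 2
      ≤ ∑ n ∈ Finset.Icc 1 P, (5 * (U / 2) + 20 + 65 * P) * (G₀ * (1 / ((n : ℝ) * (1 + (L' - Real.log n) ^ 2)))) := by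
        refine Finset.sum_le_sum fun n hn => mul_le_mul ?_ (han n hn) (by positivity) (by positivity)
        have : (n : ℝ) ≤ P := by exact_mod_cast (Finset.mem_Icc.1 hn).2
        linarith
    _ = (5 * (U / 2) + 20 + 65 * P) * (G₀ * ∑ n ∈ Finset.Icc 1 P, 1 / ((n : ℝ) * (1 + (L' - Real.log n) ^ 2))) := by
        rw [← Finset.mul_sum, ← Finset.mul_sum]
    _ ≤ (5 * (U / 2) + 20 + 65 * P) * (G₀ * (1 + 3 * π)) := by
        gcongr; exact UniversalFactor.narrowUpper_sum_logfree_of L' P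

/-! ## Freezing the slowly varying coefficients -/

/-- **Freezing cost.** With `‖G(ω) − G(ω')‖ ≤ G₁|ω − ω'|`, for `0 < T' ≤ t`:
`‖D(t) − D_{T'}(t)‖ ≤ √P G₁ (t − T')/T'` (`∑_{n≤P} n^{-1/2} ≤ 2√P`, `½ log(t/T') ≤ (t − T')/(2T')`). [folklore] -/
theorem UniversalFactor.narrowUpper_frozen_diff_le {G : ℝ → ℂ} {G₁ : ℝ}
    (hG4 : ∀ ω ω' : ℝ, ‖G ω - G ω'‖ ≤ G₁ * |ω - ω'|) (hG₁ : 0 ≤ G₁) (P : ℕ) {T' t : ℝ} (hT' : 0 < T')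
    (ht : T' ≤ t) :
    ‖∑ n ∈ Finset.Icc 1 P, ((((n : ℝ) ^ (-(1 / 2 : ℝ))) : ℝ) : ℂ) * cexp (-(I * t * Real.log n)) *
          G (1 / 2 * Real.log (t / (2 * π)) - Real.log n) -
        ∑ n ∈ Finset.Icc 1 P, ((((n : ℝ) ^ (-(1 / 2 : ℝ))) : ℝ) : ℂ) * cexp (-(I * t * Real.log n)) *
          G (1 / 2 * Real.log (T' / (2 * π)) - Real.log n)‖ ≤
      Real.sqrt P * G₁ * ((t - T') / T') := by
  have ht0 : 0 < t := hT'.trans_le ht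
  have h2π : (0:ℝ) < 2 * π := by positivity
  have hlog : 1 / 2 * Real.log (t / (2 * π)) - 1 / 2 * Real.log (T' / (2 * π)) = 1 / 2 * Real.log (t / T') := by
    rw [Real.log_div ht0.ne' h2π.ne', Real.log_div hT'.ne' h2π.ne', Real.log_div ht0.ne' hT'.ne']; ring
  have hlog0 : 0 ≤ Real.log (t / T') := Real.log_nonneg ((one_le_div hT').2 ht)
  have hlog1 : Real.log (t / T') ≤ (t - T') / T' := by
    have := Real.log_le_sub_one_of_pos (show 0 < t / T' by positivity)
    rwa [div_sub_one hT'.ne'] at this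
  rw [← Finset.sum_sub_distrib]
  refine (norm_sum_le _ _).trans ?_
  have hterm : ∀ n ∈ Finset.Icc 1 P,
      ‖((((n : ℝ) ^ (-(1 / 2 : ℝ))) : ℝ) : ℂ) * cexp (-(I * t * Real.log n)) *
            G (1 / 2 * Real.log (t / (2 * π)) - Real.log n) -
          ((((n : ℝ) ^ (-(1 / 2 : ℝ))) : ℝ) : ℂ) * cexp (-(I * t * Real.log n)) *
            G (1 / 2 * Real.log (T' / (2 * π)) - Real.log n)‖ ≤
        (n : ℝ) ^ (-(1 / 2 : ℝ)) * (G₁ * ((t - T') / (2 * T'))) := by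
    intro n hn
    have hn1 : 1 ≤ n := (Finset.mem_Icc.1 hn).1
    rw [← mul_sub, norm_mul, UniversalFactor.narrowUpper_norm_coef_mul_cexp hn1]
    refine mul_le_mul_of_nonneg_left ?_ (Real.rpow_nonneg (Nat.cast_nonneg n) _)
    refine (hG4 _ _).trans ?_
    rw [show 1 / 2 * Real.log (t / (2 * π)) - Real.log n - (1 / 2 * Real.log (T' / (2 * π)) - Real.log n) =
      1 / 2 * Real.log (t / (2 * π)) - 1 / 2 * Real.log (T' / (2 * π)) by ring, hlog,
      abs_of_nonneg (by positivity)]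
    refine mul_le_mul_of_nonneg_left ?_ hG₁
    rw [show (t - T') / (2 * T') = 1 / 2 * ((t - T') / T') by field_simp]
    exact mul_le_mul_of_nonneg_left hlog1 (by norm_num)
  refine (Finset.sum_le_sum hterm).trans ?_
  rw [← Finset.sum_mul]
  have hs := AFE.sum_Icc_rpow_neg_half_le P
  have hq : 0 ≤ G₁ * ((t - T') / (2 * T')) := by
    have : 0 ≤ t - T' := by linarith
    positivity
  calc (∑ n ∈ Finset.Icc 1 P, (n : ℝ) ^ (-(1 / 2 : ℝ))) * (G₁ * ((t - T') / (2 * T')))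
      ≤ (2 * Real.sqrt P) * (G₁ * ((t - T') / (2 * T'))) := mul_le_mul_of_nonneg_right hs hq
    _ = Real.sqrt P * G₁ * ((t - T') / T') := by ring

/-- Continuity of `t ↦ D(t)` on `(0, ∞)` (`G` is Lipschitz, hence continuous). [folklore] -/
theorem UniversalFactor.narrowUpper_continuousOn_main {G : ℝ → ℂ} {G₁ : ℝ}
    (hG4 : ∀ ω ω' : ℝ, ‖G ω - G ω'‖ ≤ G₁ * |ω - ω'|) (P : ℕ) :
    ContinuousOn (fun t : ℝ => ∑ n ∈ Finset.Icc 1 P, ((((n : ℝ) ^ (-(1 / 2 : ℝ))) : ℝ) : ℂ) *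
        cexp (-(I * t * Real.log n)) * G (1 / 2 * Real.log (t / (2 * π)) - Real.log n)) (Ioi 0) := by
  have hGc : Continuous G := by
    refine (LipschitzWith.of_dist_le_mul (K := G₁.toNNReal) fun x y => ?_).continuous
    rw [dist_eq_norm, Real.dist_eq, Real.coe_toNNReal']
    exact (hG4 x y).trans (mul_le_mul_of_nonneg_right (le_max_left _ _) (abs_nonneg _))
  refine continuousOn_finsetSum _ fun n _ => ?_
  refine ContinuousOn.mul (Continuous.continuousOn (by fun_prop)) ?_
  refine hGc.comp_continuousOn ?_
  refine ContinuousOn.sub (continuousOn_const.mul ?_) continuousOn_const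
  exact Real.continuousOn_log.comp (continuousOn_id.div_const _) fun t ht =>
    div_ne_zero (ne_of_gt ht) (by positivity)

/-- The frozen polynomial `t ↦ D_{T'}(t)` is continuous on `ℝ`. [folklore] -/
theorem UniversalFactor.narrowUpper_continuous_frozen (G : ℝ → ℂ) (P : ℕ) (L' : ℝ) :
    Continuous (fun t : ℝ => ∑ n ∈ Finset.Icc 1 P, ((((n : ℝ) ^ (-(1 / 2 : ℝ))) : ℝ) : ℂ) *
        cexp (-(I * t * Real.log n)) * G (L' - Real.log n)) := by
  fun_prop

/-! ## One block -/

/-- **One block.** For `T' ≥ 1`, `U > 0`: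
`∫_{T'}^{T'+U} ‖D‖² ≤ 2 (5U/2 + 20 + 65P) G₀(1+3π) + 2 (√P G₁ U/T')² U`
(`‖D‖ ≤ ‖D_{T'}‖ + √P G₁ U/T'` on the block). [folklore] -/
theorem UniversalFactor.narrowUpper_block_le {G : ℝ → ℂ} {G₀ G₁ : ℝ}
    (hG3 : ∀ ω : ℝ, ‖G ω‖ ^ 2 ≤ G₀ / (1 + ω ^ 2)) (hG4 : ∀ ω ω' : ℝ, ‖G ω - G ω'‖ ≤ G₁ * |ω - ω'|)
    (hG₀ : 0 ≤ G₀) (hG₁ : 0 ≤ G₁) (P : ℕ) {T' U : ℝ} (hT' : 1 ≤ T') (hU : 0 < U) :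
    ∫ t in T'..(T' + U), ‖∑ n ∈ Finset.Icc 1 P, ((((n : ℝ) ^ (-(1 / 2 : ℝ))) : ℝ) : ℂ) *
        cexp (-(I * t * Real.log n)) * G (1 / 2 * Real.log (t / (2 * π)) - Real.log n)‖ ^ 2 ≤
      2 * ((5 * (U / 2) + 20 + 65 * P) * (G₀ * (1 + 3 * π))) + 2 * (Real.sqrt P * G₁ * (U / T')) ^ 2 * U := by
  have hT0 : 0 < T' := by linarith
  set D : ℝ → ℂ := fun t => ∑ n ∈ Finset.Icc 1 P, ((((n : ℝ) ^ (-(1 / 2 : ℝ))) : ℝ) : ℂ) *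
    cexp (-(I * t * Real.log n)) * G (1 / 2 * Real.log (t / (2 * π)) - Real.log n) with hD
  set D' : ℝ → ℂ := fun t => ∑ n ∈ Finset.Icc 1 P, ((((n : ℝ) ^ (-(1 / 2 : ℝ))) : ℝ) : ℂ) *
    cexp (-(I * t * Real.log n)) * G (1 / 2 * Real.log (T' / (2 * π)) - Real.log n) with hD'
  set δ : ℝ := Real.sqrt P * G₁ * (U / T') with hδ
  have hδ0 : 0 ≤ δ := by positivity
  have hDc : ContinuousOn D (Icc T' (T' + U)) :=
    (UniversalFactor.narrowUpper_continuousOn_main hG4 P).mono fun t ht => hT0.trans_le ht.1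
  have hD'c : Continuous D' := UniversalFactor.narrowUpper_continuous_frozen G P _
  have hpt : ∀ t ∈ Icc T' (T' + U), ‖D t‖ ^ 2 ≤ 2 * ‖D' t‖ ^ 2 + 2 * δ ^ 2 := by
    intro t ht
    have h1 : ‖D t‖ ≤ ‖D' t‖ + ‖D t - D' t‖ := norm_le_norm_add_norm_sub' _ _
    have h2 : ‖D t - D' t‖ ≤ δ := by
      refine (UniversalFactor.narrowUpper_frozen_diff_le hG4 hG₁ P hT0 ht.1).trans ?_
      rw [hδ]
      refine mul_le_mul_of_nonneg_left (div_le_div_of_nonneg_right (by linarith [ht.2]) hT0.le) (by positivity)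
    have h3 : ‖D t‖ ≤ ‖D' t‖ + δ := by linarith
    nlinarith [norm_nonneg (D t), norm_nonneg (D' t), sq_nonneg (‖D' t‖ - δ)]
  have hintL : IntervalIntegrable (fun t => ‖D t‖ ^ 2) volume T' (T' + U) :=
    ((hDc.norm.pow 2).mono (by rw [uIcc_of_le (by linarith)])).intervalIntegrable
  have hc2 : Continuous fun t => 2 * ‖D' t‖ ^ 2 := continuous_const.mul ((hD'c.norm).pow 2)
  have hintR : IntervalIntegrable (fun t => 2 * ‖D' t‖ ^ 2 + 2 * δ ^ 2) volume T' (T' + U) :=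
    (hc2.add continuous_const).intervalIntegrable _ _
  have hmono := intervalIntegral.integral_mono_on (by linarith) hintL hintR hpt
  refine hmono.trans ?_
  rw [intervalIntegral.integral_add (hc2.intervalIntegrable _ _) _root_.intervalIntegrable_const,
    intervalIntegral.integral_const_mul, intervalIntegral.integral_const, smul_eq_mul,
    show T' + U - T' = U by ring]
  have hfrozen := UniversalFactor.narrowUpper_frozen_meanSquare hG3 hG₀ P (1 / 2 * Real.log (T' / (2 * π))) T' hU
  have : ∫ t in T'..(T' + U), ‖D' t‖ ^ 2 ≤ (5 * (U / 2) + 20 + 65 * P) * (G₀ * (1 + 3 * π)) := hfrozen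
  nlinarith

/-! ## The sum over blocks -/

/-- Block numerics: with `m = ⌈√(T+1)⌉`, `U = (T+1)/m`, `P ≤ √T`, `T ≥ 1`:
`m (2(5U/2 + 20 + 65P) A + 2 (√P G₁ U/T)² U) ≤ (690 A + 16 G₁²) T`. [folklore] -/
theorem UniversalFactor.narrowUpper_block_numerics {T A G₁ : ℝ} {P m : ℕ} (hT : 1 ≤ T) (hA : 0 ≤ A)
    (hP : (P : ℝ) ≤ Real.sqrt T) (hm1 : Real.sqrt (T + 1) ≤ m) (hm2 : (m : ℝ) < Real.sqrt (T + 1) + 1) :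
    (m : ℝ) * (2 * ((5 * ((T + 1) / m / 2) + 20 + 65 * P) * A) +
        2 * (Real.sqrt P * G₁ * ((T + 1) / m / T)) ^ 2 * ((T + 1) / m)) ≤
      (690 * A + 16 * G₁ ^ 2) * T := by
  have hT0 : 0 < T := by linarith
  have hs1 : 1 ≤ Real.sqrt (T + 1) := Real.one_le_sqrt.2 (by linarith)
  have hm0 : (0 : ℝ) < m := by linarith
  have hsq : Real.sqrt (T + 1) ^ 2 = T + 1 := Real.sq_sqrt (by linarith)
  have hsT : Real.sqrt T ≤ Real.sqrt (T + 1) := Real.sqrt_le_sqrt (by linarith)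
  have hP0 : (0 : ℝ) ≤ P := Nat.cast_nonneg P
  have hPs : Real.sqrt P ^ 2 = P := Real.sq_sqrt hP0
  set s := Real.sqrt (T + 1) with hs
  -- `U = (T+1)/m ≤ s`
  have hU : (T + 1) / m ≤ s := by
    rw [div_le_iff₀ hm0]; nlinarith
  have hU0 : 0 ≤ (T + 1) / m := by positivity
  -- first part: `m · 2 (5U/2 + 20 + 65 P) A = (5(T+1) + 40 m + 130 m P) A ≤ 345 (T+1) A`
  have h1 : (m : ℝ) * (2 * ((5 * ((T + 1) / m / 2) + 20 + 65 * P) * A)) =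
      (5 * (T + 1) + 40 * m + 130 * (m * P)) * A := by
    field_simp
    ring
  have hmle : (m : ℝ) ≤ 2 * (T + 1) := by nlinarith
  have hmP : (m : ℝ) * P ≤ 2 * (T + 1) := by
    have : (m : ℝ) * P ≤ (s + 1) * s := mul_le_mul hm2.le (hP.trans hsT) hP0 (by positivity)
    nlinarith
  have hpart1 : (m : ℝ) * (2 * ((5 * ((T + 1) / m / 2) + 20 + 65 * P) * A)) ≤ 690 * A * T := by
    rw [h1]
    have : 5 * (T + 1) + 40 * m + 130 * (m * P) ≤ 690 * T := by nlinarith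
    exact (mul_le_mul_of_nonneg_right this hA).trans (by nlinarith)
  -- second part: `m · 2 (√P G₁ U/T)² U = 2 P G₁² U² (T+1)/T² ≤ 16 G₁² T`
  have h2 : (m : ℝ) * (2 * (Real.sqrt P * G₁ * ((T + 1) / m / T)) ^ 2 * ((T + 1) / m)) =
      2 * G₁ ^ 2 * (P * ((T + 1) / m) ^ 2 * (T + 1) / T ^ 2) := by
    rw [mul_pow, mul_pow, hPs]
    field_simp
  have hPT : (P : ℝ) ≤ T := hP.trans (by nlinarith [Real.sq_sqrt hT0.le, Real.sqrt_nonneg T])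
  have hU2 : ((T + 1) / m) ^ 2 ≤ T + 1 := by
    calc ((T + 1) / m) ^ 2 ≤ s ^ 2 := pow_le_pow_left₀ hU0 hU 2
      _ = T + 1 := hsq
  have hpart2 : (m : ℝ) * (2 * (Real.sqrt P * G₁ * ((T + 1) / m / T)) ^ 2 * ((T + 1) / m)) ≤ 16 * G₁ ^ 2 * T := by
    rw [h2]
    have hq : P * ((T + 1) / m) ^ 2 * (T + 1) / T ^ 2 ≤ 8 * T := by
      rw [div_le_iff₀ (by positivity)]
      have : (P : ℝ) * ((T + 1) / m) ^ 2 * (T + 1) ≤ T * (T + 1) * (T + 1) :=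
        mul_le_mul (mul_le_mul hPT hU2 (by positivity) hT0.le) le_rfl (by linarith) (by positivity)
      nlinarith
    nlinarith [sq_nonneg G₁]
  linarith

/-- **The main term in mean square, log-free.** For `T ≥ 1` and `P ≤ √T`:
`∫_T^{2T+1} ‖∑_{n≤P} n^{-1/2} e^{-it log n} G(½log(t/2π) − log n)‖² dt ≤ (690 G₀(1+3π) + 16 G₁²) T`.
[cite: Titchmarsh1986, §7.3] -/
theorem UniversalFactor.narrowUpper_main_meanSquare_of {G : ℝ → ℂ} {G₀ G₁ : ℝ}
    (hG3 : ∀ ω : ℝ, ‖G ω‖ ^ 2 ≤ G₀ / (1 + ω ^ 2)) (hG4 : ∀ ω ω' : ℝ, ‖G ω - G ω'‖ ≤ G₁ * |ω - ω'|)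
    (hG₀ : 0 ≤ G₀) (hG₁ : 0 ≤ G₁) {T : ℝ} (hT : 1 ≤ T) (P : ℕ) (hP : (P : ℝ) ≤ Real.sqrt T) :
    ∫ t in T..(2 * T + 1), ‖∑ n ∈ Finset.Icc 1 P, ((((n : ℝ) ^ (-(1 / 2 : ℝ))) : ℝ) : ℂ) *
        cexp (-(I * t * Real.log n)) * G (1 / 2 * Real.log (t / (2 * π)) - Real.log n)‖ ^ 2 ≤
      (690 * (G₀ * (1 + 3 * π)) + 16 * G₁ ^ 2) * T := by
  have hT0 : 0 < T := by linarith
  set D : ℝ → ℂ := fun t => ∑ n ∈ Finset.Icc 1 P, ((((n : ℝ) ^ (-(1 / 2 : ℝ))) : ℝ) : ℂ) *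
    cexp (-(I * t * Real.log n)) * G (1 / 2 * Real.log (t / (2 * π)) - Real.log n) with hD
  set m : ℕ := ⌈Real.sqrt (T + 1)⌉₊ with hm
  have hs1 : 1 ≤ Real.sqrt (T + 1) := Real.one_le_sqrt.2 (by linarith)
  have hm1 : Real.sqrt (T + 1) ≤ m := Nat.le_ceil _
  have hm2 : (m : ℝ) < Real.sqrt (T + 1) + 1 := Nat.ceil_lt_add_one (by positivity)
  have hm0 : (0 : ℝ) < m := by linarith
  have hmne : (m : ℝ) ≠ 0 := hm0.ne'
  set U : ℝ := (T + 1) / m with hU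
  have hU0 : 0 < U := by positivity
  set α : ℕ → ℝ := fun j => T + U * j with hα
  have hα0 : α 0 = T := by simp [hα]
  have hαm : α m = 2 * T + 1 := by
    simp only [hα, hU]; field_simp; ring
  have hαsucc : ∀ j, α (j + 1) = α j + U := fun j => by simp only [hα]; push_cast; ring
  have hαT : ∀ j : ℕ, T ≤ α j := fun j => by
    simp only [hα]
    have : (0:ℝ) ≤ U * j := by positivity
    linarith
  have hDc := UniversalFactor.narrowUpper_continuousOn_main hG4 P
  have hint : ∀ j < m, IntervalIntegrable (fun t => ‖D t‖ ^ 2) volume (α j) (α (j + 1)) := by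
    intro j _
    refine (((hDc.norm.pow 2).mono ?_)).intervalIntegrable
    rw [hαsucc, uIcc_of_le (by linarith)]
    exact fun t ht => hT0.trans_le ((hαT j).trans ht.1)
  have hsum := intervalIntegral.sum_integral_adjacent_intervals hint
  rw [hα0, hαm] at hsum
  rw [← hsum]
  have hblock : ∀ j ∈ Finset.range m, ∫ t in α j..α (j + 1), ‖D t‖ ^ 2 ≤
      2 * ((5 * (U / 2) + 20 + 65 * P) * (G₀ * (1 + 3 * π))) + 2 * (Real.sqrt P * G₁ * (U / T)) ^ 2 * U := by
    intro j _
    rw [hαsucc]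
    have h := UniversalFactor.narrowUpper_block_le hG3 hG4 hG₀ hG₁ P (hT.trans (hαT j)) hU0
    refine h.trans ?_
    have : (Real.sqrt P * G₁ * (U / α j)) ^ 2 ≤ (Real.sqrt P * G₁ * (U / T)) ^ 2 := by
      refine pow_le_pow_left₀ (by have := hαT j; positivity) ?_ 2
      exact mul_le_mul_of_nonneg_left (div_le_div_of_nonneg_left hU0.le hT0 (hαT j)) (by positivity)
    nlinarith
  refine (Finset.sum_le_sum hblock).trans ?_
  rw [Finset.sum_const, Finset.card_range, nsmul_eq_mul]
  exact UniversalFactor.narrowUpper_block_numerics hT (by positivity) hP hm1 hm2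

/-- **Registered sub-stub `narrowUpper_main_meanSquare`** (verbatim signature): the log-free mean square of the filtered Dirichlet polynomial (blocks, freezing, Montgomery–Vaughan). [folklore] -/
theorem UniversalFactor.narrowUpper_main_meanSquare : ∀ {G : ℝ → ℂ} {G₀ G₁ : ℝ}, (∀ ω : ℝ, ‖G ω‖ ^ 2 ≤ G₀ / (1 + ω ^ 2)) → (∀ ω ω' : ℝ, ‖G ω - G ω'‖ ≤ G₁ * |ω - ω'|) → 0 ≤ G₀ → 0 ≤ G₁ → ∀ {T : ℝ}, 1 ≤ T → ∀ P : ℕ, (P : ℝ) ≤ Real.sqrt T → ∫ t in T..(2 * T + 1), ‖∑ n ∈ Finset.Icc 1 P, ((((n : ℝ) ^ (-(1 / 2 : ℝ))) : ℝ) : ℂ) * Complex.exp (-(Complex.I * t * Real.log n)) * G (1 / 2 * Real.log (t / (2 * Real.pi)) - Real.log n)‖ ^ 2 ≤ (690 * (G₀ * (1 + 3 * Real.pi)) + 16 * G₁ ^ 2) * T :=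
  fun hG3 hG4 hG₀ hG₁ _ hT P hP => UniversalFactor.narrowUpper_main_meanSquare_of hG3 hG4 hG₀ hG₁ hT P hP

end Summit.RiemannHypothesis.RiemannHypothesis.Theorems
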